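import Summits.QuantumFields.YangMills.Theorems.ColdStartUniversalityLatticeLangevinLawAbsCont
import Summits.QuantumFields.YangMills.Theorems.ColdStartUniversalityLatticeLangevinPlaquetteLaplacian
import HarnessLib

/-!
# Route `ColdStartUniversality` (fixed-cut-off package, explicit constants): the ground-state comparison of the SZZ dynamics with the
# `β' = 0` dynamics WITH EXPLICIT CONSTANTS — `E f(X^z_t) ≤ exp(48|β'|·#E·t + 2|β'|·#𝒫) · E f(Y^z_t)`

Helper file (seat `ym-line-csu-p1`, g27; `--supports stmt-QuantumFields-24809`).  g8's `integral_le_exp_mul_integral_beta_zero` (the upper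
Feynman–Kac / ground-state comparison between the SU(2) SZZ flow `X` at coupling `β'` and the Brownian flow `Y` at `β' = 0`) produces
constants `K, Mψ` by compactness only.  With the explicit lower bound of the ground-state potential `V̂ ≥ −48|β'|·#E`
(`groundStatePotential_ge_explicit`) and `|ψ̂| ≤ 2|β'|·#𝒫` (`abs_psiHat_coords_le`, both `…PlaquetteLaplacian`) the same proof gives
* ★★ `integral_le_exp_mul_integral_beta_zero_explicit` — for continuous `0 ≤ f ≤ 1`, every start `z` and lattice time `t`:
  `E f(X^z_t) ≤ exp(48|β'|·#E·t + 2|β'|·#𝒫) · E f(Y^z_t)`  (`#E = #𝒫 = 3L³` on `(ℤ/L)³`).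
Proof: verbatim g8 (ground-state SUBsolution inequality `groundState_subsolution` in ridge form + uniform ridge approximation), with
`K = 48|β'|·#E`, `Mψ = 2|β'|·#𝒫`.  THEOREMS ONLY, no definition, no sorry.  HONEST FRAMING: fixed-cut-off plumbing towards an explicit
cold-start density / entropy budget; nothing K-uniform; no crux, rung or summit statement is proved; the Yang–Mills mass gap is NOT proved.
-/

set_option autoImplicit false

noncomputable section

namespace Summit.QuantumFields.YangMills.Theorems.ColdStartUniversality

open MeasureTheory ProbabilityTheory Finset Metric Filter
open scoped BigOperators Topology NNReal ENNReal
open Literature.Probability.Process Literature.MathematicalPhysics.QuantumFieldTheory Literature.Analysis.SpecialFunctions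
open Literature.MathematicalPhysics.QuantumLattice (fundamentalRep fundamentalLatticeRep continuous_fundamentalRep
  fundamentalRep_injective fundamentalRep_mem_unitaryGroup)

variable {L : ℕ} [NeZero L]

/-- ★★ **Upper comparison with the `β' = 0` dynamics, explicit constants**: for continuous `0 ≤ f ≤ 1`,
`E f(X^z_t) ≤ exp(48|β'|·#E·t + 2|β'|·#𝒫) · E f(Y^z_t)` (`X` the SZZ flow at `β'`, `Y` at `β' = 0`, regular-flow clause). [folklore] -/
theorem integral_le_exp_mul_integral_beta_zero_explicit (β' : ℝ)
    {Ω : Type} [MeasurableSpace Ω] {P : Measure Ω} [IsProbabilityMeasure P]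
    {W : ℝ≥0 → Ω → (Edge 3 L × NoiseIdx 2 → ℝ)} (hW : IsFlatBrownian W P)
    (U : GaugeConfig 3 L (Matrix.specialUnitaryGroup (Fin 2) ℂ) → ℝ≥0 → Ω →
      GaugeConfig 3 L (Matrix.specialUnitaryGroup (Fin 2) ℂ))
    (hU : ∀ x, (∀ ω, U x 0 ω = x) ∧
      (latticeLangevinDynamics (fundamentalLatticeRep 2) β').IsSolution (fundamentalRep (Fin 2))
        hW.natFiltration P W (U x))
    (hUm : ∀ i : ℝ≥0, Measurable[@Prod.instMeasurableSpace (Set.Iic i)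
        (GaugeConfig 3 L (Matrix.specialUnitaryGroup (Fin 2) ℂ) × Ω) inferInstance
        (@Prod.instMeasurableSpace (GaugeConfig 3 L (Matrix.specialUnitaryGroup (Fin 2) ℂ)) Ω inferInstance
          (hW.natFiltration i))]
      (fun q : Set.Iic i × (GaugeConfig 3 L (Matrix.specialUnitaryGroup (Fin 2) ℂ) × Ω) => U q.2.1 q.1 q.2.2))
    {Ω' : Type} [MeasurableSpace Ω'] {P' : Measure Ω'} [IsProbabilityMeasure P']
    {W' : ℝ≥0 → Ω' → (Edge 3 L × NoiseIdx 2 → ℝ)} (hW' : IsFlatBrownian W' P')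
    (Y : GaugeConfig 3 L (Matrix.specialUnitaryGroup (Fin 2) ℂ) → ℝ≥0 → Ω' →
      GaugeConfig 3 L (Matrix.specialUnitaryGroup (Fin 2) ℂ))
    (hY : ∀ x, (∀ ω, Y x 0 ω = x) ∧
      (latticeLangevinDynamics (fundamentalLatticeRep 2) 0).IsSolution (fundamentalRep (Fin 2))
        hW'.natFiltration P' W' (Y x))
    (hYm : ∀ i : ℝ≥0, Measurable[@Prod.instMeasurableSpace (Set.Iic i)
        (GaugeConfig 3 L (Matrix.specialUnitaryGroup (Fin 2) ℂ) × Ω') inferInstance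
        (@Prod.instMeasurableSpace (GaugeConfig 3 L (Matrix.specialUnitaryGroup (Fin 2) ℂ)) Ω' inferInstance
          (hW'.natFiltration i))]
      (fun q : Set.Iic i × (GaugeConfig 3 L (Matrix.specialUnitaryGroup (Fin 2) ℂ) × Ω') => Y q.2.1 q.1 q.2.2)) :
    ∀ (f : GaugeConfig 3 L (Matrix.specialUnitaryGroup (Fin 2) ℂ) → ℝ), Continuous f → (∀ V, 0 ≤ f V) →
      (∀ V, f V ≤ 1) → ∀ (z : GaugeConfig 3 L (Matrix.specialUnitaryGroup (Fin 2) ℂ)) (t : ℝ≥0),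
        ∫ ω, f (U z t ω) ∂P ≤ Real.exp ((48 * |β'| * (Fintype.card (Edge 3 L) : ℝ)) * t + (2 * |β'| * (Fintype.card (Plaquette 3 L) : ℝ))) * ∫ ω', f (Y z t ω') ∂P' := by
  classical
  haveI := secondCountableTopology_su2
  haveI := borelSpace_config L
  intro f hf hf0 hf1 z t
  -- the explicit constants, made opaque
  obtain ⟨K, hKdef⟩ : ∃ K : ℝ, (48 * |β'| * (Fintype.card (Edge 3 L) : ℝ)) = K := ⟨_, rfl⟩
  obtain ⟨Mψ, hMψdef⟩ : ∃ M : ℝ, (2 * |β'| * (Fintype.card (Plaquette 3 L) : ℝ)) = M := ⟨_, rfl⟩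
  rw [hKdef, hMψdef]
  obtain ⟨-, -, hψc, -⟩ := exists_groundState_bounds (L := L) β'
  -- the plaquette function on the group and the ground state
  set ψV : GaugeConfig 3 L (Matrix.specialUnitaryGroup (Fin 2) ℂ) → ℝ := fun V =>
      β' * ∑ p : Plaquette 3 L, (rootedLoop (fun (e : Edge 3 L) (i j : Fin 2) =>
        ((((fundamentalRep (Fin 2) (V e) : Matrix (Fin 2) (Fin 2) ℂ) i j).re : ℝ) : ℂ) +
          ((((fundamentalRep (Fin 2) (V e) : Matrix (Fin 2) (Fin 2) ℂ) i j).im : ℝ) : ℂ) * Complex.I)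
        (p.1, p.2.1.1) p.2.1.2 false).trace.re with hψVdef
  set φ : GaugeConfig 3 L (Matrix.specialUnitaryGroup (Fin 2) ℂ) → ℝ := fun V => Real.exp (-(1 / 2 : ℝ) * ψV V) with hφdef
  have hφc : Continuous φ := Real.continuous_exp.comp (continuous_const.mul hψc)
  have hφpos : ∀ V, 0 < φ V := fun V => Real.exp_pos _
  have hψVabs : ∀ V, |ψV V| ≤ Mψ := fun V => by
    rw [← hMψdef]
    exact abs_psiHat_coords_le (L := L) β' V
  have hφup : ∀ V, φ V ≤ Real.exp (Mψ / 2) := fun V => by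
    rw [hφdef]; apply Real.exp_le_exp.2
    have := (abs_le.1 (hψVabs V)).1; linarith
  have hφlow : ∀ V, Real.exp (-(Mψ / 2)) ≤ φ V := fun V => by
    rw [hφdef]; apply Real.exp_le_exp.2
    have := (abs_le.1 (hψVabs V)).2; linarith
  -- measurability / integrability boilerplate
  have hmU : Measurable (U z t) := ((hU z).2.adapted t).mono (hW.natFiltration.le t) le_rfl
  have hmY : Measurable (Y z t) := ((hY z).2.adapted t).mono (hW'.natFiltration.le t) le_rfl
  have hint : ∀ {g : GaugeConfig 3 L (Matrix.specialUnitaryGroup (Fin 2) ℂ) → ℝ}, Continuous g →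
      Integrable (fun ω => g (U z t ω)) P ∧ Integrable (fun ω' => g (Y z t ω')) P' := by
    intro g hg
    obtain ⟨M, -, hM⟩ := exists_abs_le_of_continuous hg
    exact ⟨Integrable.of_bound (hg.measurable.comp hmU).aestronglyMeasurable M
        (Eventually.of_forall fun ω => by rw [Real.norm_eq_abs]; exact hM _),
      Integrable.of_bound (hg.measurable.comp hmY).aestronglyMeasurable M
        (Eventually.of_forall fun ω => by rw [Real.norm_eq_abs]; exact hM _)⟩
  -- `G = f / φ`
  set G : GaugeConfig 3 L (Matrix.specialUnitaryGroup (Fin 2) ℂ) → ℝ := fun V => f V / φ V with hGdef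
  have hGc : Continuous G := hf.div hφc fun V => (hφpos V).ne'
  have hG0 : ∀ V, 0 ≤ G V := fun V => div_nonneg (hf0 V) (hφpos V).le
  have hφG : ∀ V, φ V * G V = f V := fun V => by rw [hGdef]; field_simp [(hφpos V).ne']
  have hGup : ∀ V, G V ≤ Real.exp (Mψ / 2) * f V := by
    intro V
    rw [hGdef, div_le_iff₀ (hφpos V)]
    calc f V = (Real.exp (Mψ / 2) * Real.exp (-(Mψ / 2))) * f V := by rw [← Real.exp_add]; simp
      _ ≤ (Real.exp (Mψ / 2) * φ V) * f V :=
          mul_le_mul_of_nonneg_right (mul_le_mul_of_nonneg_left (hφlow V) (Real.exp_pos _).le) (hf0 V)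
      _ = Real.exp (Mψ / 2) * f V * φ V := by ring
  -- approximation by latitude eigenfunctions, keeping nonnegativity
  have hmain : ∀ ε : ℝ, 0 < ε →
      Real.exp (-(K * t)) * ∫ ω, f (U z t ω) ∂P ≤ Real.exp (Mψ / 2) * (Real.exp (Mψ / 2) * ∫ ω', f (Y z t ω') ∂P' + 2 * ε) := by
    intro ε hε
    obtain ⟨κ, hκ, c, g, m, hF⟩ := exists_ridge_uniform_near (L := L) hGc hε
    obtain ⟨κ', hκ', c', g', m', hF'⟩ := exists_ridge_add ⟨κ, hκ, c, g, m, fun V => rfl⟩ (exists_ridge_const (L := L) ε)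
    have hF'0 : ∀ V : GaugeConfig 3 L (Matrix.specialUnitaryGroup (Fin 2) ℂ), 0 ≤ ∑ l, c' l * ∏ e, gegenbauerSum 1 (m' l e)
        (hsForm 2 (fundamentalRep (Fin 2) (g' l e)) (fundamentalRep (Fin 2) (V e)) / 2) := by
      intro V; rw [← hF' V]
      have := (abs_lt.1 (hF V)).1
      linarith [hG0 V]
    have hF'G : ∀ V : GaugeConfig 3 L (Matrix.specialUnitaryGroup (Fin 2) ℂ),
        G V ≤ ∑ l, c' l * ∏ e, gegenbauerSum 1 (m' l e)
          (hsForm 2 (fundamentalRep (Fin 2) (g' l e)) (fundamentalRep (Fin 2) (V e)) / 2) ∧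
        ∑ l, c' l * ∏ e, gegenbauerSum 1 (m' l e)
          (hsForm 2 (fundamentalRep (Fin 2) (g' l e)) (fundamentalRep (Fin 2) (V e)) / 2) ≤ G V + 2 * ε := by
      intro V; rw [← hF' V]
      have h := abs_lt.1 (hF V)
      constructor <;> linarith [h.1, h.2]
    have hsub := groundState_subsolution (L := L) β' hW U hU hUm hW' Y hY hYm c' g' m' hF'0 K
      (fun V => by
        have h := groundStatePotential_ge_explicit L β' V
        rw [← hKdef]
        exact h) z t
    dsimp only at hsub
    have hRc : Continuous fun V : GaugeConfig 3 L (Matrix.specialUnitaryGroup (Fin 2) ℂ) =>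
        ∑ l, c' l * ∏ e, gegenbauerSum 1 (m' l e)
          (hsForm 2 (fundamentalRep (Fin 2) (g' l e)) (fundamentalRep (Fin 2) (V e)) / 2) :=
      continuous_finsetSum _ fun l _ => continuous_const.mul (continuous_prod_gegenbauer_latitude (L := L) (g' l) (m' l))
    -- `E f(X) = E[φ G(X)] ≤ E[φ F'(X)]`
    have hleft : ∫ ω, f (U z t ω) ∂P ≤ ∫ ω, φ (U z t ω) * (∑ l, c' l * ∏ e, gegenbauerSum 1 (m' l e)
        (hsForm 2 (fundamentalRep (Fin 2) (g' l e)) (fundamentalRep (Fin 2) (U z t ω e)) / 2)) ∂P := by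
      refine integral_mono (hint hf).1 (hint (hφc.mul hRc)).1 fun ω => ?_
      dsimp only
      rw [← hφG]
      exact mul_le_mul_of_nonneg_left (hF'G _).1 (hφpos _).le
    -- `φ(z) E F'(Y) ≤ Φmax (E G(Y) + 2ε) ≤ Φmax (Φmax E f(Y) + 2ε)`
    have hright : φ z * ∫ ω', (∑ l, c' l * ∏ e, gegenbauerSum 1 (m' l e)
        (hsForm 2 (fundamentalRep (Fin 2) (g' l e)) (fundamentalRep (Fin 2) (Y z t ω' e)) / 2)) ∂P' ≤
        Real.exp (Mψ / 2) * (Real.exp (Mψ / 2) * ∫ ω', f (Y z t ω') ∂P' + 2 * ε) := by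
      have h1 : ∫ ω', (∑ l, c' l * ∏ e, gegenbauerSum 1 (m' l e)
          (hsForm 2 (fundamentalRep (Fin 2) (g' l e)) (fundamentalRep (Fin 2) (Y z t ω' e)) / 2)) ∂P' ≤
          ∫ ω', (Real.exp (Mψ / 2) * f (Y z t ω') + 2 * ε) ∂P' := by
        refine integral_mono (hint hRc).2 (((hint hf).2.const_mul _).add (integrable_const _)) fun ω' => ?_
        exact (hF'G _).2.trans (by linarith [hGup (Y z t ω')])
      rw [integral_add ((hint hf).2.const_mul _) (integrable_const _), integral_const, smul_eq_mul, probReal_univ, one_mul,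
        MeasureTheory.integral_const_mul] at h1
      have h0 : 0 ≤ ∫ ω', (∑ l, c' l * ∏ e, gegenbauerSum 1 (m' l e)
          (hsForm 2 (fundamentalRep (Fin 2) (g' l e)) (fundamentalRep (Fin 2) (Y z t ω' e)) / 2)) ∂P' :=
        integral_nonneg fun ω' => hF'0 _
      calc φ z * _ ≤ Real.exp (Mψ / 2) * ∫ ω', (∑ l, c' l * ∏ e, gegenbauerSum 1 (m' l e)
            (hsForm 2 (fundamentalRep (Fin 2) (g' l e)) (fundamentalRep (Fin 2) (Y z t ω' e)) / 2)) ∂P' :=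
            mul_le_mul_of_nonneg_right (hφup z) h0
        _ ≤ _ := mul_le_mul_of_nonneg_left h1 (Real.exp_pos _).le
    calc Real.exp (-(K * t)) * ∫ ω, f (U z t ω) ∂P
        ≤ Real.exp (-(K * t)) * ∫ ω, φ (U z t ω) * (∑ l, c' l * ∏ e, gegenbauerSum 1 (m' l e)
            (hsForm 2 (fundamentalRep (Fin 2) (g' l e)) (fundamentalRep (Fin 2) (U z t ω e)) / 2)) ∂P :=
          mul_le_mul_of_nonneg_left hleft (Real.exp_pos _).le
      _ ≤ φ z * ∫ ω', (∑ l, c' l * ∏ e, gegenbauerSum 1 (m' l e)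
            (hsForm 2 (fundamentalRep (Fin 2) (g' l e)) (fundamentalRep (Fin 2) (Y z t ω' e)) / 2)) ∂P' := hsub
      _ ≤ _ := hright
  -- let `ε → 0` and unwind
  have hlim : Real.exp (-(K * t)) * ∫ ω, f (U z t ω) ∂P ≤ Real.exp (Mψ / 2) * (Real.exp (Mψ / 2) * ∫ ω', f (Y z t ω') ∂P') := by
    refine le_of_forall_pos_le_add fun δ hδ => ?_
    have hpos : 0 < 2 * Real.exp (Mψ / 2) := by positivity
    have h := hmain (δ / (2 * Real.exp (Mψ / 2))) (div_pos hδ hpos)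
    have heq : Real.exp (Mψ / 2) * (Real.exp (Mψ / 2) * ∫ ω', f (Y z t ω') ∂P' + 2 * (δ / (2 * Real.exp (Mψ / 2)))) =
        Real.exp (Mψ / 2) * (Real.exp (Mψ / 2) * ∫ ω', f (Y z t ω') ∂P') + δ := by
      field_simp
    linarith [h, heq]
  have hexp : Real.exp (K * t + Mψ) = (Real.exp (-(K * t)))⁻¹ * (Real.exp (Mψ / 2) * Real.exp (Mψ / 2)) := by
    rw [← Real.exp_neg, ← Real.exp_add, ← Real.exp_add]; congr 1; ring
  rw [hexp, mul_assoc, mul_assoc]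
  rw [← inv_mul_le_iff₀ (inv_pos.2 (Real.exp_pos _)), inv_inv]
  exact hlim

end Summit.QuantumFields.YangMills.Theorems.ColdStartUniversality
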